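import Literature.AlgebraicGeometry.Resolution.StrictNormalCrossingsSpread
import Literature.AlgebraicGeometry.Resolution.StrictNormalCrossingsFlatDescent
import Literature.AlgebraicGeometry.Resolution.ArtinApproximation
import Literature.AlgebraicGeometry.Resolution.FormalNormalCrossingsAlgebra
import Literature.AlgebraicGeometry.Resolution.FormalNormalCrossingsFormal
import Literature.AlgebraicGeometry.Resolution.FormalNormalCrossingsSystem
import Literature.AlgebraicGeometry.Resolution.AlterationsNormalFormBlowup
import Literature.AlgebraicGeometry.Resolution.AdicQuotient
import Literature.AlgebraicGeometry.Resolution.AlterationsDimension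
import Literature.AlgebraicGeometry.Resolution.AffineDomainEquidim
import HarnessLib

/-!
# The formal-to-étale bridge: formal normal crossings are normal crossings, given Artin
approximation (de Jong 1996, 4.25 (i)/4.28; Artin 1969, Cor. 2.1)

Topic: `Literature/AlgebraicGeometry/Resolution`. This file DISCHARGES the leaf
`DeJong1996FormalNormalCrossings` of `DeJong1996NormalFormPairResolution`
(`AlterationsNormalFormBlowup.lean`) from the classical named fact
`Artin1969EtaleApproximation` (`ArtinApproximation.lean`):
`DeJong1996FormalNormalCrossings.of_artinApproximation`. The argument, implicit in de Jong
1996 between the complete-local-ring description 4.25 (i)/4.27 and the étale-local Definition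
2.4 invoked in 4.28:

* `exists_etale_isStrictNormalCrossingsAt_of_formal` — at a point `x` of `X` (locally of finite
  type over a field `k`) with `𝒪_{X,x}` regular of dimension `d` and
  `(𝒪̂_{X,x}, Î_Z) ≅ (k⟦X₁, …, X_d⟧, (X₁ ⋯ X_r))`, there is an étale `g : U → X` and `u ↦ x`
  such that `g⁻¹ Z` satisfies the strict normal crossings condition AT `u`
  (`IsStrictNormalCrossingsAt`). Proof: on an affine chart `W ∋ x` the formal isomorphism
  solves the coordinate system (E1)–(E4) (`bridgeSystem`, `exists_formal_solution`) in
  `𝒪̂_{W,x}`; Artin's Cor. 2.1 gives a solution over an étale neighbourhood `S' → W` of `x`;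
  on an affine open `U ⊆ S'` around the lifted point the algebraic core
  (`isSNCIdeal_radical_of_etale_solution`: étale over regular is regular, unramifiedness,
  preservation of heights, Matsumura 14.2) shows that the radical of `I_Z 𝒪_{U,u}` — which is
  the stalk of the ideal of the closed set `g⁻¹ Z` — has local strict normal crossings data.
* `DeJong1996FormalNormalCrossings.of_artinApproximation` — for a pair in Situation 4.25
  (`DeJong1996.NormalFormPair f Z d`) with `X` regular: at every closed point of `Z` the above
  applies (`dim 𝒪_{X,x} = dim X = d` at closed points of the variety `X`); the condition
  spreads to a neighbourhood (`StrictNormalCrossingsSpread.lean`), and closed points suffice on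
  the Jacobson scheme `X` (`NormalCrossingsLocal.lean`), so `Z` is a normal crossings divisor.

## Sources

* A. J. de Jong, *Smoothness, semi-stability and alterations*, Publ. Math. IHÉS 83 (1996),
  2.4, 4.25–4.28.
* M. Artin, *Algebraic approximation of structures over complete local rings*, Publ. Math.
  IHÉS 36 (1969), Cor. 2.1, Cor. 2.6.
* The Stacks Project, Tags 0BI9, 0BSF, 0CBS.
-/

noncomputable section

open CategoryTheory AlgebraicGeometry TopologicalSpace IsLocalRing

universe u

namespace Literature.AlgebraicGeometry.Resolution

open Scheme.IdealSheafData

/-! ## Plumbing: germs, restrictions, stalk maps -/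

/-- Germs of sections pulled back along `f`: `germ_V ∘ f^*_{U,V} = f^*_x ∘ germ_U`. [folklore] -/
theorem appLE_comp_germ {X Y : Scheme.{u}} (f : X ⟶ Y) (U : Y.Opens) (V : X.Opens)
    (e : V ≤ f ⁻¹ᵁ U) (x : X) (hx : x ∈ V) :
    f.appLE U V e ≫ X.presheaf.germ V x hx = Y.presheaf.germ U (f x) (e hx) ≫ f.stalkMap x := by
  rw [Scheme.Hom.appLE, Category.assoc, X.presheaf.germ_res (homOfLE e) x hx,
    Scheme.Hom.germ_stalkMap]

/-- For an open `W ⊆ X`, the isomorphism `Γ(X, W) ≅ Γ(W, ⊤)` is the pull-back `W.ι^*`.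
[folklore] -/
theorem Scheme.Opens.topIso_inv_eq_appLE {X : Scheme.{u}} (W : X.Opens) :
    W.topIso.inv = W.ι.appLE W ⊤ (by rw [Scheme.Opens.ι_preimage_self]) := by
  rw [Scheme.Opens.ι_appLE, Scheme.Opens.topIso_inv]
  rfl

/-- Germs on an open subscheme: `germ_{W,⊤} ∘ (Γ(X, W) ≅ Γ(W, ⊤)) = W.ι^*_w ∘ germ_{X,W}`.
[folklore] -/
theorem Scheme.Opens.topIso_inv_comp_germ {X : Scheme.{u}} (W : X.Opens) (w : W) :
    W.topIso.inv ≫ W.toScheme.presheaf.germ ⊤ w trivial =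
      X.presheaf.germ W w.1 w.2 ≫ W.ι.stalkMap w := by
  rw [Scheme.Opens.topIso_inv_eq_appLE]
  exact appLE_comp_germ W.ι W ⊤ _ w trivial

/-- The ideal sheaf of the reduced closed subscheme on the preimage of a closed set is the
radical of the pull-back ideal sheaf. [folklore] -/
theorem vanishingIdeal_preimage_eq_radical_comap {U X : Scheme.{u}} (g : U ⟶ X) {Z : Set X}
    (hZ : IsClosed Z) :
    vanishingIdeal ⟨g ⁻¹' Z, hZ.preimage g.continuous⟩ = ((vanishingIdeal ⟨Z, hZ⟩).comap g).radical := by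
  symm
  apply eq_vanishingIdeal_of_radical
  · apply Scheme.IdealSheafData.ext
    funext V
    rw [radical_ideal, radical_ideal, Ideal.radical_idem]
  · rw [support_radical, support_comap]
    ext1
    rw [Closeds.coe_preimage, coe_support_vanishingIdeal]
    rfl

/-! ## The formal solution, transported to the affine chart -/

/-- Steps (1)–(3) of `exists_etale_isStrictNormalCrossingsAt_of_formal`: on an affine open
`W ∋ x`, with generators `g` of `I_Z(W)` and `t` of the prime of `x`, the formal isomorphism
`(𝒪̂_{X,x}, Î_Z) ≅ (k⟦X⟧, (X₁ ⋯ X_r))` gives a solution of the bridge system (E1)–(E4), with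
coefficients moved to `Γ(W, ⊤)`, in the completion `𝒪̂_{W,x}` — the input of
`Artin1969EtaleApproximation` on the affine scheme `W`. [folklore] -/
theorem exists_formal_bridge_solution {k : Type u} [Field k] {X : Scheme.{u}}
    [IsLocallyNoetherian X] {W : X.Opens} (hW : IsAffineOpen W) {x : X} (hxW : x ∈ W)
    {Z : Set X} (hZ : IsClosed Z) {d r m n : ℕ} (gI : Fin m → Γ(X, W))
    (hgI : Ideal.span (Set.range gI) = (vanishingIdeal ⟨Z, hZ⟩).ideal ⟨W, hW⟩)
    (t : Fin n → Γ(X, W)) (ht : Ideal.span (Set.range t) = (hW.primeIdealOf ⟨x, hxW⟩).asIdeal)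
    (e : AdicCompletion (maximalIdeal (X.presheaf.stalk x)) (X.presheaf.stalk x) ≃+*
      MvPowerSeries (Fin d) k)
    (he : (completedStalkIdeal (vanishingIdeal ⟨Z, hZ⟩) x ⟨W, hW⟩ hxW).map e.toRingHom =
      Ideal.span {DeJong1996.normalCrossingsEquation k d r}) :
    ∃ wb : BridgeVar d m n → AdicCompletion
        (maximalIdeal ((W : Scheme.{u}).presheaf.stalk ⟨x, hxW⟩))
        ((W : Scheme.{u}).presheaf.stalk ⟨x, hxW⟩),
      ∀ κ, MvPolynomial.eval₂ ((algebraMap _ (AdicCompletion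
          (maximalIdeal ((W : Scheme.{u}).presheaf.stalk ⟨x, hxW⟩))
          ((W : Scheme.{u}).presheaf.stalk ⟨x, hxW⟩))).comp
        ((W : Scheme.{u}).presheaf.germ ⊤ ⟨x, hxW⟩ trivial).hom) wb
        (MvPolynomial.map W.topIso.inv.hom (bridgeSystem d r gI t κ)) = 0 := by
  classical
  letI algA := TopCat.Presheaf.algebra_section_stalk X.presheaf (⟨x, hxW⟩ : W)
  haveI hlocA := hW.isLocalization_stalk ⟨x, hxW⟩
  have hγ : algebraMap Γ(X, W) (X.presheaf.stalk x) = (X.presheaf.germ W x hxW).hom := rfl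
  have ht' : (Ideal.span (Set.range t)).map (X.presheaf.germ W x hxW).hom =
      maximalIdeal (X.presheaf.stalk x) := by
    rw [ht, ← hγ]
    exact IsLocalization.AtPrime.map_eq_maximalIdeal (hW.primeIdealOf ⟨x, hxW⟩).asIdeal _
  have he' : (((Ideal.span (Set.range gI)).map (X.presheaf.germ W x hxW).hom).map
      (algebraMap _ (AdicCompletion (maximalIdeal (X.presheaf.stalk x))
        (X.presheaf.stalk x)))).map e.toRingHom =
      Ideal.span {∏ i ∈ Finset.univ.filter (fun i : Fin d => (i : ℕ) < r), MvPowerSeries.X i} := by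
    rw [hgI]
    exact he
  -- the formal solution in `𝒪̂_{X,x}`
  obtain ⟨yb, ab, bb, cb, db, h1, h2, h3, h4⟩ :=
    exists_formal_solution (X.presheaf.germ W x hxW).hom gI t ht' e he'
  let ι : Γ(X, W) →+* AdicCompletion (maximalIdeal (X.presheaf.stalk x)) (X.presheaf.stalk x) :=
    (algebraMap (X.presheaf.stalk x) _).comp (X.presheaf.germ W x hxW).hom
  let vb : BridgeVar d m n → AdicCompletion (maximalIdeal (X.presheaf.stalk x)) (X.presheaf.stalk x) :=
    Sum.elim yb (Sum.elim ab (Sum.elim bb (Sum.elim (fun p => cb p.1 p.2) fun p => db p.1 p.2)))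
  have hvb : ∀ κ, MvPolynomial.eval₂ ι vb (bridgeSystem d r gI t κ) = 0 :=
    (bridgeSystem_eval₂_eq_zero_iff ι gI t vb).mpr ⟨h1, h2, h3, h4⟩
  -- transport along `θ : 𝒪_{X,x} ≅ 𝒪_{W,x}`
  let θ : X.presheaf.stalk x ≃+* (W : Scheme.{u}).presheaf.stalk ⟨x, hxW⟩ :=
    (asIso (W.ι.stalkMap ⟨x, hxW⟩)).commRingCatIsoToRingEquiv
  have hθ : (θ : X.presheaf.stalk x →+* _) = (W.ι.stalkMap ⟨x, hxW⟩).hom := rfl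
  have hθmax : (maximalIdeal (X.presheaf.stalk x)).map θ.toRingHom =
      maximalIdeal ((W : Scheme.{u}).presheaf.stalk ⟨x, hxW⟩) :=
    IsLocalRing.eq_maximalIdeal (Ideal.map_isMaximal_of_equiv θ (p := maximalIdeal _))
  let θhat := adicCompletionCongr (maximalIdeal (X.presheaf.stalk x))
    (maximalIdeal ((W : Scheme.{u}).presheaf.stalk ⟨x, hxW⟩)) θ hθmax
  have hρ : ∀ a, ((W : Scheme.{u}).presheaf.germ ⊤ ⟨x, hxW⟩ trivial).hom (W.topIso.inv.hom a) =
      θ ((X.presheaf.germ W x hxW).hom a) := by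
    intro a
    change (W.topIso.inv ≫ (W : Scheme.{u}).presheaf.germ ⊤ ⟨x, hxW⟩ trivial).hom a = _
    rw [Scheme.Opens.topIso_inv_comp_germ]
    rfl
  have hcomm : ((algebraMap _ (AdicCompletion
      (maximalIdeal ((W : Scheme.{u}).presheaf.stalk ⟨x, hxW⟩))
      ((W : Scheme.{u}).presheaf.stalk ⟨x, hxW⟩))).comp
        ((W : Scheme.{u}).presheaf.germ ⊤ ⟨x, hxW⟩ trivial).hom).comp W.topIso.inv.hom =
      (θhat : _ →+* _).comp ι := by
    refine RingHom.ext fun a => ?_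
    simp only [RingHom.comp_apply, hρ, AdicCompletion.algebraMap_apply, Algebra.algebraMap_self,
      RingHom.id_apply, ι]
    exact (adicCompletionCongr_of _ _ θ hθmax _).symm
  refine ⟨θhat ∘ vb, fun κ => ?_⟩
  rw [MvPolynomial.eval₂_map, hcomm,
    show (θhat ∘ vb : BridgeVar d m n → _) = (θhat : _ →+* _) ∘ vb from rfl,
    ← MvPolynomial.eval₂_comp_left, hvb κ, map_zero]

/-! ## The pointwise theorem -/

/-- **Formal normal crossings give strict normal crossings at a point of an étale
neighbourhood, given Artin approximation** (see the module docstring). [folklore] -/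
theorem exists_etale_isStrictNormalCrossingsAt_of_formal (hA : Artin1969EtaleApproximation.{u})
    {k : Type u} [Field k] {X : Scheme.{u}} (f : X ⟶ Spec (.of k)) [LocallyOfFiniteType f]
    {Z : Set X} (hZ : IsClosed Z) {x : X} (hreg : IsRegularLocalRing (X.presheaf.stalk x))
    {d r : ℕ} (hr : 1 ≤ r) (hrd : r ≤ d) (hdim : ringKrullDim (X.presheaf.stalk x) = d)
    (e : AdicCompletion (maximalIdeal (X.presheaf.stalk x)) (X.presheaf.stalk x) ≃+*
      MvPowerSeries (Fin d) k)
    (he : ∀ (U : X.affineOpens) (hU : x ∈ (U : X.Opens)),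
      (completedStalkIdeal (vanishingIdeal ⟨Z, hZ⟩) x U hU).map e.toRingHom =
        Ideal.span {DeJong1996.normalCrossingsEquation k d r}) :
    ∃ (U : Scheme.{u}) (g : U ⟶ X), Etale g ∧ ∃ u : U, g u = x ∧
      IsStrictNormalCrossingsAt U (g ⁻¹' Z) u := by
  classical
  haveI : IsLocallyNoetherian X := LocallyOfFiniteType.isLocallyNoetherian f
  /- (1) an affine chart `W ∋ x`; generators of `I_Z(W)` and of the prime of `x` -/
  obtain ⟨W, hW, hxW, -⟩ :=
    exists_isAffineOpen_mem_and_subset (X := X) (x := x) (U := ⊤) trivial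
  haveI : IsAffine W := hW
  haveI : IsNoetherianRing Γ(X, W) := IsLocallyNoetherian.component_noetherian ⟨W, hW⟩
  obtain ⟨m, gI, hgI⟩ := Submodule.fg_iff_exists_fin_generating_family.mp
    (IsNoetherian.noetherian ((vanishingIdeal ⟨Z, hZ⟩).ideal ⟨W, hW⟩))
  obtain ⟨n, t, ht⟩ := Submodule.fg_iff_exists_fin_generating_family.mp
    (IsNoetherian.noetherian (hW.primeIdealOf ⟨x, hxW⟩).asIdeal)
  change Ideal.span (Set.range gI) = (vanishingIdeal ⟨Z, hZ⟩).ideal ⟨W, hW⟩ at hgI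
  change Ideal.span (Set.range t) = (hW.primeIdealOf ⟨x, hxW⟩).asIdeal at ht
  /- (2)–(3) the formal solution of the bridge system on `W` -/
  obtain ⟨wb, hwb⟩ := exists_formal_bridge_solution hW hxW hZ gI hgI t ht e (he ⟨W, hW⟩ hxW)
  /- (4) Artin approximation on `W` (of finite type over `k`) -/
  haveI : QuasiCompact (W.ι ≫ f) :=
    (HasAffineProperty.iff_of_isAffine (P := @QuasiCompact)).mpr inferInstance
  obtain ⟨S', e', s', hs, ysol, he', -, hsol⟩ :=
    hA.exists_etale_solution (W.ι ≫ f) (⟨x, hxW⟩ : W) _ wb hwb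
  -- the point `s'` lies over `x`; make this definitional
  have hx : (e' s').1 = x := congrArg Subtype.val hs
  subst hx
  haveI := he'
  haveI := hreg
  letI algA := TopCat.Presheaf.algebra_section_stalk X.presheaf (⟨(e' s').1, hxW⟩ : W)
  haveI hlocA := hW.isLocalization_stalk ⟨(e' s').1, hxW⟩
  /- (5) an affine open `V' ∋ s'`; the étale neighbourhood `g = (V'.ι ≫ e') ≫ W.ι` of `x` -/
  obtain ⟨V', hV', hs'V', -⟩ :=
    exists_isAffineOpen_mem_and_subset (X := S') (x := s') (U := ⊤) trivial
  haveI : IsAffine V' := hV'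
  let u : (V' : Scheme.{u}) := ⟨s', hs'V'⟩
  haveI : Etale (V'.ι ≫ e') := inferInstance
  refine ⟨V', (V'.ι ≫ e') ≫ W.ι, inferInstance, u, by simp only [Scheme.Hom.comp_apply]; rfl, ?_⟩
  /- (6) the étale `Γ(X, W)`-algebra `Γ(V', ⊤)` and the prime `𝔮` of `u` -/
  let ρ' : Γ(X, W) →+* Γ(V', ⊤) := ((V'.ι ≫ e').appTop).hom.comp W.topIso.inv.hom
  have hρbij : Function.Bijective W.topIso.inv.hom :=
    W.topIso.commRingCatIsoToRingEquiv.symm.bijective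
  have hρ'et : ρ'.Etale :=
    RingHom.Etale.stableUnderComposition _ _ (RingHom.Etale.of_bijective hρbij)
      ((HasRingHomProperty.iff_of_isAffine (P := @Etale)).mp ‹Etale (V'.ι ≫ e')›)
  letI : Algebra Γ(X, W) Γ(V', ⊤) := ρ'.toAlgebra
  haveI : Algebra.Etale Γ(X, W) Γ(V', ⊤) := hρ'et
  letI algB := TopCat.Presheaf.algebra_section_stalk (V' : Scheme.{u}).presheaf
    (⟨u, trivial⟩ : (⊤ : (V' : Scheme.{u}).Opens))
  haveI hlocB := (isAffineOpen_top (V' : Scheme.{u})).isLocalization_stalk ⟨u, trivial⟩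
  set 𝔮 := ((isAffineOpen_top (V' : Scheme.{u})).primeIdealOf ⟨u, trivial⟩).asIdeal with h𝔮
  -- the plumbing identity `germ_u ∘ ρ' = g^*_u ∘ germ_x`
  have hPL : ∀ a, ((V' : Scheme.{u}).presheaf.germ ⊤ u trivial).hom (ρ' a) =
      (((V'.ι ≫ e') ≫ W.ι).stalkMap u).hom ((X.presheaf.germ W (e' s').1 hxW).hom a) := by
    intro a
    change ((V' : Scheme.{u}).presheaf.germ ⊤ u trivial).hom
      ((V'.ι ≫ e').appTop.hom (W.topIso.inv.hom a)) = _
    have h1 : ((V' : Scheme.{u}).presheaf.germ ⊤ u trivial).hom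
        ((V'.ι ≫ e').appTop.hom (W.topIso.inv.hom a)) =
        ((V'.ι ≫ e').stalkMap u).hom
          (((W : Scheme.{u}).presheaf.germ ⊤ ((V'.ι ≫ e') u) trivial).hom (W.topIso.inv.hom a)) :=
      (Scheme.Hom.germ_stalkMap_apply (V'.ι ≫ e') ⊤ u trivial (W.topIso.inv.hom a)).symm
    have h2 : ((W : Scheme.{u}).presheaf.germ ⊤ ((V'.ι ≫ e') u) trivial).hom (W.topIso.inv.hom a) =
        (W.ι.stalkMap ((V'.ι ≫ e') u)).hom ((X.presheaf.germ W (e' s').1 hxW).hom a) := by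
      change (W.topIso.inv ≫ (W : Scheme.{u}).presheaf.germ ⊤ ((V'.ι ≫ e') u) trivial).hom a = _
      rw [Scheme.Opens.topIso_inv_comp_germ]
      rfl
    rw [h1, h2, Scheme.Hom.stalkMap_comp (V'.ι ≫ e') W.ι u]
    rfl
  have hPL' : ((V' : Scheme.{u}).presheaf.germ ⊤ u trivial).hom.comp ρ' =
      (((V'.ι ≫ e') ≫ W.ι).stalkMap u).hom.comp (X.presheaf.germ W (e' s').1 hxW).hom :=
    RingHom.ext hPL
  -- `𝔮` lies over the prime of `x`
  have hunder : 𝔮.under Γ(X, W) = (hW.primeIdealOf ⟨(e' s').1, hxW⟩).asIdeal := by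
    ext a
    rw [← IsLocalization.AtPrime.to_map_mem_maximal_iff (X.presheaf.stalk (e' s').1)
        (hW.primeIdealOf ⟨(e' s').1, hxW⟩).asIdeal]
    change ρ' a ∈ 𝔮 ↔ (X.presheaf.germ W (e' s').1 hxW).hom a ∈ _
    rw [← IsLocalization.AtPrime.to_map_mem_maximal_iff ((V' : Scheme.{u}).presheaf.stalk u) 𝔮]
    change ((V' : Scheme.{u}).presheaf.germ ⊤ u trivial).hom (ρ' a) ∈ _ ↔ _
    rw [hPL, mem_maximalIdeal, mem_maximalIdeal, mem_nonunits_iff, mem_nonunits_iff,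
      isUnit_map_iff]
    exact Iff.rfl
  haveI hlocA' : IsLocalization.AtPrime (X.presheaf.stalk (e' s').1) (𝔮.under Γ(X, W)) := by
    have hM : (𝔮.under Γ(X, W)).primeCompl =
        (hW.primeIdealOf ⟨(e' s').1, hxW⟩).asIdeal.primeCompl := by
      ext a
      change a ∉ 𝔮.under Γ(X, W) ↔ a ∉ _
      rw [hunder]
      exact Iff.rfl
    unfold IsLocalization.AtPrime
    rw [hM]
    exact hlocA
  /- (7) the equations hold in `Γ(V', ⊤)` -/
  have hsol' : ∀ κ, MvPolynomial.eval₂ (algebraMap Γ(X, W) Γ(V', ⊤))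
      (fun v => (V'.ι.appTop).hom (ysol v)) (bridgeSystem d r gI t κ) = 0 := by
    intro κ
    have h0 := congrArg (V'.ι.appTop).hom (hsol κ)
    rw [map_zero, MvPolynomial.eval₂_comp_left, MvPolynomial.eval₂_map] at h0
    have hρ'eq : algebraMap Γ(X, W) Γ(V', ⊤) =
        ((V'.ι.appTop).hom.comp (e'.appTop).hom).comp W.topIso.inv.hom := by
      rw [RingHom.algebraMap_toAlgebra]
      change (Scheme.Hom.appTop (V'.ι ≫ e')).hom.comp W.topIso.inv.hom = _
      rw [Scheme.Hom.comp_appTop]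
      rfl
    rw [hρ'eq]
    exact h0
  obtain ⟨hE1, hE2, hE3, hE4⟩ := (bridgeSystem_eval₂_eq_zero_iff _ gI t _).mp hsol'
  have hAC := isSNCIdeal_radical_of_etale_solution (R := Γ(X, W)) 𝔮
    (X.presheaf.stalk (e' s').1) ((V' : Scheme.{u}).presheaf.stalk u) hdim hr hrd gI t
    (ht.trans hunder.symm) _ _ _ _ _ hE1 hE2 hE3 hE4
  /- (8) identify the ideal of `g⁻¹ Z` at `u` with the radical of `I_Z 𝒪_{V',u}` -/
  unfold IsStrictNormalCrossingsAt
  have hcl : (⟨closure (((V'.ι ≫ e') ≫ W.ι) ⁻¹' Z), isClosed_closure⟩ : Closeds (V' : Scheme.{u})) =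
      ⟨((V'.ι ≫ e') ≫ W.ι) ⁻¹' Z, hZ.preimage ((V'.ι ≫ e') ≫ W.ι).continuous⟩ :=
    Closeds.ext (hZ.preimage ((V'.ι ≫ e') ≫ W.ι).continuous).closure_eq
  have hrad : ∀ J : Ideal Γ(V', ⊤),
      (J.radical).map ((V' : Scheme.{u}).presheaf.germ ⊤ u trivial).hom =
        (J.map ((V' : Scheme.{u}).presheaf.germ ⊤ u trivial).hom).radical := fun J =>
    IsLocalization.map_radical 𝔮.primeCompl ((V' : Scheme.{u}).presheaf.stalk u) J
  rw [hcl, vanishingIdeal_preimage_eq_radical_comap ((V'.ι ≫ e') ≫ W.ι) hZ,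
    stalkIdeal_eq_map_germ _ ⟨⊤, isAffineOpen_top _⟩ trivial, radical_ideal, hrad,
    ← stalkIdeal_eq_map_germ _ ⟨⊤, isAffineOpen_top _⟩ trivial,
    Scheme.IdealSheafData.comap_comp, stalkIdeal_comap (V'.ι ≫ e'),
    stalkIdeal_comap_of_isOpenImmersion W.ι, Ideal.map_map, ← CommRingCat.hom_comp,
    ← Scheme.Hom.stalkMap_comp]
  change IsSNCIdeal (((stalkIdeal (vanishingIdeal ⟨Z, hZ⟩) (e' s').1).map
    (((V'.ι ≫ e') ≫ W.ι).stalkMap u).hom).radical)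
  rw [stalkIdeal_eq_map_germ _ ⟨W, hW⟩ hxW, ← hgI]
  have hideal : ((Ideal.span (Set.range gI)).map (X.presheaf.germ W (e' s').1 hxW).hom).map
      (((V'.ι ≫ e') ≫ W.ι).stalkMap u).hom =
      ((Ideal.span (Set.range gI)).map (algebraMap Γ(X, W) Γ(V', ⊤))).map
        (algebraMap Γ(V', ⊤) ((V' : Scheme.{u}).presheaf.stalk u)) := by
    refine (Ideal.map_map (X.presheaf.germ W (e' s').1 hxW).hom
      (((V'.ι ≫ e') ≫ W.ι).stalkMap u).hom).trans ?_
    refine Eq.trans ?_ (Ideal.map_map (algebraMap Γ(X, W) Γ(V', ⊤))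
      (algebraMap Γ(V', ⊤) ((V' : Scheme.{u}).presheaf.stalk u))).symm
    exact congrArg (fun φ => Ideal.map φ (Ideal.span (Set.range gI))) hPL'.symm
  exact hideal ▸ hAC

/-! ## De Jong 1996, 4.25 (i) ⇒ 2.4: the leaf `DeJong1996FormalNormalCrossings` from Artin
approximation -/

/-- At a closed point `p` of the variety `X` (integral, locally of finite type over a field `k`,
of dimension `d`), `dim 𝒪_{X,p} = d` (affine domains are equidimensional at maximal ideals,
tree `ringKrullDim_localization_atPrime_eq_of_isMaximal`, and `dim X = dim Γ(X, W)` on an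
affine chart, tree `topologicalKrullDim_eq_ringKrullDim_of_isAffineOpen`). A private copy of the
lemma of the same name in `AlterationsBoundarySmoothLocus.lean` (kept local to avoid importing that
file's unrelated closure). [folklore] -/
private theorem ringKrullDim_stalk_eq_topologicalKrullDim_of_isClosedPoint {k : Type u} [Field k] {X : Scheme.{u}}
    [IsIntegral X]
    (f : X ⟶ Spec (.of k)) [LocallyOfFiniteType f] {p : X} (hp : IsClosed ({p} : Set X)) :
    ringKrullDim (X.presheaf.stalk p) = topologicalKrullDim X := by
  obtain ⟨W, hW, hpW, -⟩ :=
    exists_isAffineOpen_mem_and_subset (X := X) (x := p) (U := ⊤) trivial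
  -- `Γ(X, W)` is a domain of finite type over `k`
  have hft : RingHom.FiniteType (f.appLE ⊤ W le_top).hom :=
    HasRingHomProperty.appLE @LocallyOfFiniteType f inferInstance ⟨⊤, isAffineOpen_top _⟩
      ⟨W, hW⟩ le_top
  let φ : k →+* Γ(X, W) := (f.appLE ⊤ W le_top).hom.comp (Scheme.ΓSpecIso (.of k)).inv.hom
  have hφ : φ.FiniteType :=
    hft.comp (RingHom.FiniteType.of_surjective _
      (Scheme.ΓSpecIso (.of k)).commRingCatIsoToRingEquiv.symm.surjective)
  letI : Algebra k Γ(X, W) := φ.toAlgebra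
  haveI : Algebra.FiniteType k Γ(X, W) := hφ
  haveI : Nonempty W := ⟨⟨p, hpW⟩⟩
  -- the stalk is the localisation at the maximal ideal of the closed point `p`
  letI := TopCat.Presheaf.algebra_section_stalk X.presheaf (⟨p, hpW⟩ : W)
  haveI := hW.isLocalization_stalk ⟨p, hpW⟩
  haveI hmax : (hW.primeIdealOf ⟨p, hpW⟩).asIdeal.IsMaximal :=
    hW.primeIdealOf_isMaximal_of_isClosed ⟨p, hpW⟩ hp
  rw [topologicalKrullDim_eq_ringKrullDim_of_isAffineOpen f hW ⟨p, hpW⟩,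
    ← ringKrullDim_localization_atPrime_eq_of_isMaximal k (hW.primeIdealOf ⟨p, hpW⟩).asIdeal]
  exact ringKrullDim_eq_of_ringEquiv (IsLocalization.algEquiv
    (hW.primeIdealOf ⟨p, hpW⟩).asIdeal.primeCompl (X.presheaf.stalk p)
    (Localization.AtPrime (hW.primeIdealOf ⟨p, hpW⟩).asIdeal)).toRingEquiv

/-- **`Artin1969EtaleApproximation → DeJong1996FormalNormalCrossings`**: for a pair `(X, Z)` in
Situation 4.25 (`DeJong1996.NormalFormPair f Z d`) with `X` regular, `Z` is a normal crossings
divisor in the sense of de Jong 1996, 2.4 — given Artin's approximation theorem (Artin 1969,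
Cor. 2.1). At each closed point `p ∈ Z` the formal condition 4.25 (i) yields an étale
neighbourhood on which the preimage of `Z` is a strict normal crossings divisor
(`exists_etale_isStrictNormalCrossingsAt_of_formal`, then openness,
`IsStrictNormalCrossingsAt.exists_isStrictNormalCrossingsDivisor_preimage`); closed points
suffice on the Jacobson scheme `X` (`IsNormalCrossingsDivisor.of_forall_closedPoints_exists_etale`).
[cite: DeJong1996, 2.4 and 4.25 (i), pp. 55, 75] -/
theorem DeJong1996FormalNormalCrossings.of_artinApproximation
    (hA : Artin1969EtaleApproximation.{u}) : DeJong1996FormalNormalCrossings.{u} := by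
  intro k _ _ X f Z d hN hreg
  haveI := hN.isIntegral
  haveI : LocallyOfFiniteType f := hN.locallyOfFiniteType
  haveI : PerfectField k := IsAlgClosed.perfectField k
  haveI : JacobsonSpace X := LocallyOfFiniteType.jacobsonSpace f
  refine IsNormalCrossingsDivisor.of_forall_closedPoints_exists_etale hN.isClosed
    fun p hpZ hpcl => ?_
  -- the formal condition 4.25 (i) at the closed point `p ∈ Z`
  obtain ⟨r, hr1, hrd, e, he⟩ := hN.exists_ringEquiv_of_isRegularLocalRing p hpcl (hreg p) hpZ
  have hdim : ringKrullDim (X.presheaf.stalk p) = d := by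
    rw [ringKrullDim_stalk_eq_topologicalKrullDim_of_isClosedPoint f hpcl, hN.topologicalKrullDim_eq]
  obtain ⟨U, g, hg, u, hgu, hsnc⟩ :=
    exists_etale_isStrictNormalCrossingsAt_of_formal hA f hN.isClosed (hreg p) hr1 hrd hdim e he
  haveI := hg
  -- spread to an open neighbourhood of `u`
  obtain ⟨V, huV, hV⟩ := hsnc.exists_isStrictNormalCrossingsDivisor_preimage (g ≫ f)
    (hN.isClosed.preimage g.continuous)
  refine ⟨V, V.ι ≫ g, inferInstance, ⟨⟨u, huV⟩, ?_⟩, ?_⟩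
  · rw [← hgu]
    rfl
  · rwa [show ((V.ι ≫ g) ⁻¹' Z : Set V) = V.ι ⁻¹' (g ⁻¹' Z) by
      ext v
      simp only [Set.mem_preimage, Scheme.Hom.comp_apply]]

end Literature.AlgebraicGeometry.Resolution

end
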